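import Literature.AlgebraicGeometry.HodgeTheory.ProjectiveDegreeLinearSections
import Literature.Algebra.Homology.LaurentCechSaturatedSubmodules
import HarnessLib

/-!
# `deg (X · H_1 ⋯ H_s) = deg X · ∏ deg H_i` for hypersurfaces in general position (Hartshorne I Thm. 7.7 iterated)

Hartshorne, *Algebraic Geometry*, I Thm. 7.7 (proof, p. 53): for `Y ⊆ ℙ^r` of dimension `t ≥ 1` and a
hypersurface `H = V(f)` of degree `d` with `f` a non-zero-divisor modulo the (saturated) ideal of `Y`,
`0 → (S/I_Y)(-d) → S/I_Y → S/(I_Y + f) → 0` gives `P_{Y ∩ H}(z) = P_Y(z) - P_Y(z - d)`, so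
`dim (Y ∩ H) = t - 1` and `(t-1)!·lc(P_{Y∩H}) = d · t!·lc(P_Y)`, i.e. `deg(Y · H) = d · deg Y`.

This file iterates the step along a sequence of homogeneous forms `g_1, …, g_s` (`s ≤ t`, degrees
`c_i ≥ 1`) each of which is a non-zero-divisor modulo the SATURATION of `K + (g_1, …, g_{i-1})F_e`
("`H_i` meets `X ∩ H_1 ∩ ⋯ ∩ H_{i-1}` properly"), for a graded `M = F_e ⧸ K` with `χ`-polynomial `Q`
of degree `t` (`k` a field):

* `LaurentCech.sat_sup_ofList_cons_smul_top_eq` — `(K + (g, gs)F_e)‾ = ((K̄ + gF_e) + (gs)F_e)‾`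
  (bookkeeping: saturating along the way does not change the subscheme);
* **`LaurentCech.natDegree_and_leadingCoeff_hilbertPolynomial_hypersurfaceSections`** — the
  `χ`-polynomial `Q_s` of `F_e ⧸ (K + (g_1, …, g_s)F_e)` has `deg Q_s = t - s` and
  **`(t - s)! · lc(Q_s) = (∏ c_i) · t! · lc(Q)`**: `deg(X · H_1 ⋯ H_s) = deg X · ∏ deg H_i`, and for
  `s = t` the section is zero-dimensional of length `deg X · ∏ c_i`;
* `LaurentCech.exists_forms_hilbertPolynomial_eq_prod_mul_degree` — over an INFINITE field such
  sequences exist in all prescribed degrees `c_1, …, c_t ≥ 1` (powers of linear forms regular modulo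
  the successive saturations, `LaurentCechRegularLinearForm`): the section has constant `χ`-polynomial
  `(∏ c_i) · deg M~` (`ProjectiveDegreeLinearSections` is the case `c_i = 1`).

## References

* [Hartshorne1977] R. Hartshorne, *Algebraic Geometry*, GTM 52, Springer 1977, I Thm. 7.7 (p. 53),
  I Prop. 7.6 (p. 52), II Ex. 5.10 (p. 125).
-/

noncomputable section

open CategoryTheory CategoryTheory.Limits Polynomial Pointwise
open scoped Nat

universe u

namespace Literature.Algebra.Homology

namespace LaurentCech

open OrderedCech TopCohomology

/-! ### Bookkeeping: saturating along the way -/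

section AnyRing

variable {A : Type u} [CommRing A] {r : ℕ} {J : Type}

/-- `K + (g, gs)F_e ⊆ (K̄ + gF_e) + (gs)F_e`. [cite: Hartshorne1977, II Ex. 5.10 (p. 125)] -/
theorem sup_ofList_cons_smul_top_le (K : Submodule (P A r) (J → P A r)) (g : P A r) (gs : List (P A r)) :
    K ⊔ Ideal.ofList (g :: gs) • (⊤ : Submodule (P A r) (J → P A r)) ≤
      (sat K ⊔ g • (⊤ : Submodule (P A r) (J → P A r))) ⊔
        Ideal.ofList gs • (⊤ : Submodule (P A r) (J → P A r)) := by
  rw [Ideal.ofList_cons_smul, ← sup_assoc]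
  exact sup_le_sup_right (sup_le_sup_right (le_sat K) _) _

/-- `(K̄ + gF_e) + (gs)F_e ⊆ (K + (g, gs)F_e)‾`. [cite: Hartshorne1977, II Ex. 5.10 (p. 125)] -/
theorem sat_sup_smul_top_sup_ofList_le_sat (K : Submodule (P A r) (J → P A r)) (g : P A r)
    (gs : List (P A r)) :
    (sat K ⊔ g • (⊤ : Submodule (P A r) (J → P A r))) ⊔
        Ideal.ofList gs • (⊤ : Submodule (P A r) (J → P A r)) ≤
      sat (K ⊔ Ideal.ofList (g :: gs) • (⊤ : Submodule (P A r) (J → P A r))) := by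
  refine sup_le (sup_le (sat_mono le_sup_left) ?_) ?_
  · refine le_trans ?_ (le_sat _)
    rw [Ideal.ofList_cons_smul]
    exact le_sup_right.trans' le_sup_left
  · refine le_trans ?_ (le_sat _)
    rw [Ideal.ofList_cons_smul]
    exact le_sup_right.trans' le_sup_right

/-- **`(K + (g, gs)F_e)‾ = ((K̄ + gF_e) + (gs)F_e)‾`**: the two presentations define the same closed
subscheme `X ∩ V(g, gs)`. [cite: Hartshorne1977, II Ex. 5.10 (b) (p. 125)] -/
theorem sat_sup_ofList_cons_smul_top_eq (K : Submodule (P A r) (J → P A r)) (g : P A r)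
    (gs : List (P A r)) :
    sat (K ⊔ Ideal.ofList (g :: gs) • (⊤ : Submodule (P A r) (J → P A r))) =
      sat ((sat K ⊔ g • (⊤ : Submodule (P A r) (J → P A r))) ⊔
        Ideal.ofList gs • (⊤ : Submodule (P A r) (J → P A r))) :=
  le_antisymm (sat_le_sat_iff.2 ((sup_ofList_cons_smul_top_le K g gs).trans (le_sat _)))
    (sat_le_sat_iff.2 (sat_sup_smul_top_sup_ofList_le_sat K g gs))

end AnyRing

/-! ### Degrees multiply along proper hypersurface sections -/

section Field

variable {k : Type u} [Field k] {r : ℕ} {J : Type} [Fintype J] (e : J → ℤ)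

omit [Fintype J] in
/-- The Euler characteristics of `F_e ⧸ (K + (g, gs)F_e)` and `F_e ⧸ ((K̄ + gF_e) + (gs)F_e)` agree.
[cite: Hartshorne1977, II Ex. 5.10 (b) (p. 125)] [cite: Hartshorne1977, III Ex. 5.1 (p. 230)] -/
theorem eulerChar_quot_sup_ofList_cons_eq (K : Submodule (P k r) (J → P k r)) (g : P k r)
    (gs : List (P k r)) (n : ℤ) :
    ∑ q ∈ Finset.range (r + 1), (-1 : ℤ) ^ q *
        (Module.finrank k ((quot e (K ⊔ Ideal.ofList (g :: gs) •
          (⊤ : Submodule (P k r) (J → P k r))) n).homology q) : ℤ) =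
      ∑ q ∈ Finset.range (r + 1), (-1 : ℤ) ^ q *
        (Module.finrank k ((quot e ((sat K ⊔ g • (⊤ : Submodule (P k r) (J → P k r))) ⊔
          Ideal.ofList gs • (⊤ : Submodule (P k r) (J → P k r))) n).homology q) : ℤ) := by
  refine Finset.sum_congr rfl fun q _ => ?_
  haveI := isIso_homologyMap_quotRes_of_le_saturation e (sup_ofList_cons_smul_top_le K g gs)
    (le_sat_iff.1 (sat_sup_smul_top_sup_ofList_le_sat K g gs)) n (q : ℤ)
  rw [(asIso (HomologicalComplex.homologyMap
    (quotRes e _ _ (sup_ofList_cons_smul_top_le K g gs) n) (q : ℤ))).toLinearEquiv.finrank_eq]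

/-- **Hartshorne I Thm. 7.7 iterated: `deg(X · H_1 ⋯ H_s) = deg X · ∏ deg H_i`.** Let `M = F_e ⧸ K`
(`K` graded, `k` a field) have `χ`-polynomial `Q` of degree `t`, and let `(g_1, c_1), …, (g_s, c_s)`
(`s ≤ t`) be homogeneous forms of degrees `c_i ≥ 1` such that each `g_i` is a non-zero-divisor modulo
the saturation of `K + (g_1, …, g_{i-1})F_e`. Then the `χ`-polynomial `Q_s` of
`F_e ⧸ (K + (g_1, …, g_s)F_e)` has **`deg Q_s = t - s`** and **`(t - s)!·lc(Q_s) = (∏ c_i)·t!·lc(Q)`**.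
[cite: Hartshorne1977, I Thm. 7.7 (proof, p. 53)] [cite: Hartshorne1977, I §7 Definition (p. 52)] -/
theorem natDegree_and_leadingCoeff_hilbertPolynomial_hypersurfaceSections :
    ∀ (gcs : List (P k r × ℕ)) (K : Submodule (P k r) (J → P k r)), IsGraded e K →
      (∀ gc ∈ gcs, gc.1.IsHomogeneous gc.2 ∧ 1 ≤ gc.2) →
      (∀ (l₁ : List (P k r × ℕ)) (gc : P k r × ℕ) (l₂ : List (P k r × ℕ)), gcs = l₁ ++ gc :: l₂ →
        ∀ v : J → P k r, gc.1 • v ∈ sat (K ⊔ Ideal.ofList (l₁.map Prod.fst) •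
            (⊤ : Submodule (P k r) (J → P k r))) →
          v ∈ sat (K ⊔ Ideal.ofList (l₁.map Prod.fst) • (⊤ : Submodule (P k r) (J → P k r)))) →
      ∀ {Q Qs : ℚ[X]},
      (∀ n : ℤ, ((∑ q ∈ Finset.range (r + 1), (-1 : ℤ) ^ q *
        (Module.finrank k ((quot e K n).homology q) : ℤ) : ℤ) : ℚ) = Q.eval (n : ℚ)) →
      gcs.length ≤ Q.natDegree →
      (∀ n : ℤ, ((∑ q ∈ Finset.range (r + 1), (-1 : ℤ) ^ q *
        (Module.finrank k ((quot e (K ⊔ Ideal.ofList (gcs.map Prod.fst) •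
          (⊤ : Submodule (P k r) (J → P k r))) n).homology q) : ℤ) : ℤ) : ℚ) = Qs.eval (n : ℚ)) →
      Qs.natDegree = Q.natDegree - gcs.length ∧
        ((Q.natDegree - gcs.length)! : ℚ) * Qs.leadingCoeff =
          (gcs.map fun gc : P k r × ℕ => (gc.2 : ℚ)).prod * (((Q.natDegree)! : ℚ) * Q.leadingCoeff) := by
  intro gcs
  induction gcs with
  | nil =>
    intro K hK _ _ Q Qs hQ _ hQs
    have hKe : K ⊔ Ideal.ofList (([] : List (P k r × ℕ)).map Prod.fst) •
        (⊤ : Submodule (P k r) (J → P k r)) = K := by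
      rw [List.map_nil, Ideal.ofList_nil, Submodule.bot_smul, sup_bot_eq]
    have hQQ : Qs = Q :=
      Polynomial.eq_of_forall_intCast_eval_eq_of_le Qs Q 0 fun n _ => by rw [← hQ n, ← hQs n, hKe]
    subst hQQ
    simp only [List.length_nil, Nat.sub_zero, List.map_nil, List.prod_nil, one_mul, and_self]
  | cons gc rest ih =>
    intro K hK hhom hreg Q Qs hQ hlen hQs
    obtain ⟨g, c⟩ := gc
    -- the head: `g` homogeneous of degree `c ≥ 1`, regular modulo `K̄`
    have hgc := hhom (g, c) (List.mem_cons_self)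
    have hg : toL k r g ∈ Ldeg k r (c : ℤ) := (toL_mem_Ldeg_iff g c).2 hgc.1
    have hc0 : (c : ℤ) ≠ 0 := by have := hgc.2; omega
    have hreg0 : ∀ v : J → P k r, g • v ∈ sat K → v ∈ sat K := by
      intro v hv
      have h := hreg [] (g, c) rest rfl v
      rw [List.map_nil, Ideal.ofList_nil, Submodule.bot_smul, sup_bot_eq] at h
      exact h hv
    -- pass to `K̄` and cut by `g`
    have hKs : IsGraded e (sat K) := isGraded_sat e hK
    have hQ' : ∀ n : ℤ, ((∑ q ∈ Finset.range (r + 1), (-1 : ℤ) ^ q *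
        (Module.finrank k ((quot e (sat K) n).homology q) : ℤ) : ℤ) : ℚ) = Q.eval (n : ℚ) :=
      fun n => by rw [eulerChar_quot_sat_eq e K n]; exact hQ n
    have hK₁ : IsGraded e (sat K ⊔ g • (⊤ : Submodule (P k r) (J → P k r))) :=
      isGraded_sup_smul_top e hKs hg
    obtain ⟨Q₁, hQ₁⟩ := exists_polynomial_eulerChar_quot e hK₁
    have ht1 : 1 ≤ Q.natDegree := by rw [List.length_cons] at hlen; omega
    have hdeg₁ : Q₁.natDegree = Q.natDegree - 1 :=
      natDegree_hilbertPolynomial_sup_smul_top e hKs g hg hreg0 hc0 hQ' hQ₁ ht1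
    have hlc₁ : ((Q.natDegree - 1)! : ℚ) * Q₁.leadingCoeff =
        (c : ℚ) * (((Q.natDegree)! : ℚ) * Q.leadingCoeff) := by
      have h := factorial_mul_leadingCoeff_hilbertPolynomial_sup_smul_top e hKs g hg hreg0 hc0
        hQ' hQ₁ ht1
      rw [Int.cast_natCast] at h
      exact h
    -- the tail, relative to `K₁ = K̄ + gF_e`
    have hhom' : ∀ gc ∈ rest, gc.1.IsHomogeneous gc.2 ∧ 1 ≤ gc.2 := fun gc hgc' =>
      hhom gc (List.mem_cons_of_mem _ hgc')
    have hreg' : ∀ (l₁ : List (P k r × ℕ)) (gc : P k r × ℕ) (l₂ : List (P k r × ℕ)),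
        rest = l₁ ++ gc :: l₂ → ∀ v : J → P k r,
          gc.1 • v ∈ sat ((sat K ⊔ g • (⊤ : Submodule (P k r) (J → P k r))) ⊔
            Ideal.ofList (l₁.map Prod.fst) • (⊤ : Submodule (P k r) (J → P k r))) →
          v ∈ sat ((sat K ⊔ g • (⊤ : Submodule (P k r) (J → P k r))) ⊔
            Ideal.ofList (l₁.map Prod.fst) • (⊤ : Submodule (P k r) (J → P k r))) := by
      intro l₁ gc' l₂ hsplit v hv
      have h := hreg ((g, c) :: l₁) gc' l₂ (by rw [hsplit]; rfl) v
      rw [List.map_cons, sat_sup_ofList_cons_smul_top_eq] at h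
      exact h hv
    have hlen' : rest.length ≤ Q₁.natDegree := by
      rw [hdeg₁]; rw [List.length_cons] at hlen; omega
    have hQs' : ∀ n : ℤ, ((∑ q ∈ Finset.range (r + 1), (-1 : ℤ) ^ q *
        (Module.finrank k ((quot e ((sat K ⊔ g • (⊤ : Submodule (P k r) (J → P k r))) ⊔
          Ideal.ofList (rest.map Prod.fst) • (⊤ : Submodule (P k r) (J → P k r))) n).homology q) :
            ℤ) : ℤ) : ℚ) = Qs.eval (n : ℚ) := by
      intro n
      rw [← hQs n, List.map_cons, eulerChar_quot_sup_ofList_cons_eq]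
    obtain ⟨hdeg, hlc⟩ := ih _ hK₁ hhom' hreg' hQ₁ hlen' hQs'
    refine ⟨by rw [hdeg, hdeg₁, List.length_cons]; omega, ?_⟩
    have hsub : Q₁.natDegree - rest.length = Q.natDegree - ((g, c) :: rest).length := by
      rw [hdeg₁, List.length_cons]; omega
    rw [← hsub, hlc, List.map_cons, List.prod_cons]
    -- `(∏ rest) · ((t-1)!·lc Q₁) = (∏ rest) · (c · (t!·lc Q))`
    have ht : Q₁.natDegree = Q.natDegree - 1 := hdeg₁
    rw [ht, hlc₁]
    ring

/-- For `s = t` sections the result is a zero-dimensional scheme of length `(∏ c_i) · deg M~`: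
the `χ`-polynomial of `F_e ⧸ (K + (g_1, …, g_t)F_e)` is the constant `(∏ c_i)·t!·lc(Q)`.
[cite: Hartshorne1977, I Thm. 7.7 (proof, p. 53)] -/
theorem hilbertPolynomial_hypersurfaceSections_eq_const (gcs : List (P k r × ℕ))
    {K : Submodule (P k r) (J → P k r)} (hK : IsGraded e K)
    (hhom : ∀ gc ∈ gcs, gc.1.IsHomogeneous gc.2 ∧ 1 ≤ gc.2)
    (hreg : ∀ (l₁ : List (P k r × ℕ)) (gc : P k r × ℕ) (l₂ : List (P k r × ℕ)), gcs = l₁ ++ gc :: l₂ →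
      ∀ v : J → P k r, gc.1 • v ∈ sat (K ⊔ Ideal.ofList (l₁.map Prod.fst) •
          (⊤ : Submodule (P k r) (J → P k r))) →
        v ∈ sat (K ⊔ Ideal.ofList (l₁.map Prod.fst) • (⊤ : Submodule (P k r) (J → P k r))))
    {Q Qs : ℚ[X]}
    (hQ : ∀ n : ℤ, ((∑ q ∈ Finset.range (r + 1), (-1 : ℤ) ^ q *
      (Module.finrank k ((quot e K n).homology q) : ℤ) : ℤ) : ℚ) = Q.eval (n : ℚ))
    (hlen : gcs.length = Q.natDegree)
    (hQs : ∀ n : ℤ, ((∑ q ∈ Finset.range (r + 1), (-1 : ℤ) ^ q *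
      (Module.finrank k ((quot e (K ⊔ Ideal.ofList (gcs.map Prod.fst) •
        (⊤ : Submodule (P k r) (J → P k r))) n).homology q) : ℤ) : ℤ) : ℚ) = Qs.eval (n : ℚ)) :
    Qs = C ((gcs.map fun gc : P k r × ℕ => (gc.2 : ℚ)).prod * (((Q.natDegree)! : ℚ) * Q.leadingCoeff)) := by
  obtain ⟨hdeg, hlc⟩ := natDegree_and_leadingCoeff_hilbertPolynomial_hypersurfaceSections e gcs K hK
    hhom hreg hQ hlen.le hQs
  rw [hlen, Nat.sub_self] at hdeg hlc
  rw [Nat.factorial_zero, Nat.cast_one, one_mul] at hlc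
  rw [eq_C_of_natDegree_eq_zero hdeg, ← hlc, leadingCoeff, hdeg]

end Field

/-! ### Existence over an infinite field, in prescribed degrees -/

section Infinite

variable {k : Type u} [Field k] [Infinite k] {r : ℕ} {J : Type} [Fintype J] (e : J → ℤ)

/-- **Hypersurface sections of prescribed degrees `c_1, …, c_t ≥ 1` cutting `M~` down to length
`(∏ c_i) · deg M~`** exist over an infinite field (`K` graded with `χ`-polynomial `Q` of degree
`t`): take `g_i = ℓ_i^{c_i}` for linear forms `ℓ_i` regular modulo the successive saturations.
[cite: Hartshorne1977, I Thm. 7.7 (proof, p. 53)] [cite: Hartshorne1977, I Prop. 7.6 (a) (p. 52)] -/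
theorem exists_forms_hilbertPolynomial_eq_prod_mul_degree :
    ∀ (cs : List ℕ) (K : Submodule (P k r) (J → P k r)), IsGraded e K → (∀ c ∈ cs, 1 ≤ c) →
      ∀ {Q : ℚ[X]},
      (∀ n : ℤ, ((∑ q ∈ Finset.range (r + 1), (-1 : ℤ) ^ q *
        (Module.finrank k ((quot e K n).homology q) : ℤ) : ℤ) : ℚ) = Q.eval (n : ℚ)) →
      Q.natDegree = cs.length →
      ∃ gs : List (P k r), List.Forall₂ (fun g c => g.IsHomogeneous c ∧ g ≠ 0) gs cs ∧
        ∀ n : ℤ, ((∑ q ∈ Finset.range (r + 1), (-1 : ℤ) ^ q *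
          (Module.finrank k ((quot e (K ⊔ Ideal.ofList gs • (⊤ : Submodule (P k r) (J → P k r)))
            n).homology q) : ℤ) : ℤ) : ℚ) =
          (cs.map fun c : ℕ => (c : ℚ)).prod * (((Q.natDegree)! : ℚ) * Q.leadingCoeff) := by
  intro cs
  induction cs with
  | nil =>
    intro K hK _ Q hQ ht
    refine ⟨[], List.Forall₂.nil, fun n => ?_⟩
    have hKe : K ⊔ Ideal.ofList ([] : List (P k r)) • (⊤ : Submodule (P k r) (J → P k r)) = K := by
      rw [Ideal.ofList_nil, Submodule.bot_smul, sup_bot_eq]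
    rw [List.length_nil] at ht
    rw [hKe, hQ n, ht, Nat.factorial_zero, Nat.cast_one, one_mul, List.map_nil, List.prod_nil, one_mul]
    conv_lhs => rw [eq_C_of_natDegree_eq_zero ht, eval_C]
    rw [leadingCoeff, ht]
  | cons c cs ih =>
    intro K hK hcs Q hQ ht
    have hc1 : 1 ≤ c := hcs c (List.mem_cons_self)
    -- saturate and choose a regular linear form; cut by its `c`-th power
    have hKs : IsGraded e (sat K) := isGraded_sat e hK
    have hQs : ∀ n : ℤ, ((∑ q ∈ Finset.range (r + 1), (-1 : ℤ) ^ q *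
        (Module.finrank k ((quot e (sat K) n).homology q) : ℤ) : ℤ) : ℚ) = Q.eval (n : ℚ) :=
      fun n => by rw [eulerChar_quot_sat_eq e K n]; exact hQ n
    obtain ⟨ℓ, hℓ0, hℓ1, -, hreg⟩ := exists_linearForm_regular_sat (k := k) (r := r) (J := J) K
    have hgc : (ℓ ^ c).IsHomogeneous c := by simpa only [one_mul] using hℓ1.pow c
    have hg : toL k r (ℓ ^ c) ∈ Ldeg k r (c : ℤ) := (toL_mem_Ldeg_iff _ c).2 hgc
    have hregc : ∀ (m : ℕ) (v : J → P k r), ℓ ^ m • v ∈ sat K → v ∈ sat K := by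
      intro m
      induction m with
      | zero => intro v hv; rwa [pow_zero, one_smul] at hv
      | succ m ihm =>
        intro v hv
        rw [pow_succ, mul_smul] at hv
        exact hreg v (ihm _ hv)
    have hK₁ : IsGraded e (sat K ⊔ (ℓ ^ c) • (⊤ : Submodule (P k r) (J → P k r))) :=
      isGraded_sup_smul_top e hKs hg
    obtain ⟨Q₁, hQ₁⟩ := exists_polynomial_eulerChar_quot e hK₁
    have ht1 : 1 ≤ Q.natDegree := by rw [ht, List.length_cons]; omega
    have hc0 : (c : ℤ) ≠ 0 := by omega
    have hdeg₁ : Q₁.natDegree = cs.length := by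
      rw [natDegree_hilbertPolynomial_sup_smul_top e hKs (ℓ ^ c) hg (hregc c) hc0 hQs hQ₁ ht1, ht,
        List.length_cons, Nat.add_sub_cancel]
    have hlc₁ : ((cs.length)! : ℚ) * Q₁.leadingCoeff =
        (c : ℚ) * ((((c :: cs).length)! : ℚ) * Q.leadingCoeff) := by
      have h := factorial_mul_leadingCoeff_hilbertPolynomial_sup_smul_top e hKs (ℓ ^ c) hg (hregc c)
        hc0 hQs hQ₁ ht1
      rw [ht, List.length_cons, Nat.add_sub_cancel, Int.cast_natCast] at h
      exact h
    obtain ⟨gs, hgs, hconst⟩ := ih _ hK₁ (fun c' hc' => hcs c' (List.mem_cons_of_mem _ hc')) hQ₁ hdeg₁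
    refine ⟨ℓ ^ c :: gs, List.Forall₂.cons ⟨hgc, pow_ne_zero c hℓ0⟩ hgs, fun n => ?_⟩
    rw [Int.cast_inj.2 (eulerChar_quot_sup_ofList_cons_eq e K (ℓ ^ c) gs n), hconst n, hdeg₁, hlc₁,
      ht, List.map_cons, List.prod_cons]
    ring

end Infinite

end LaurentCech

end Literature.Algebra.Homology

end
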